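import Summits.Ventures.LatticeQCDFlow.Scoring.PlaquetteWeakCoupling
import Summits.Ventures.LatticeQCDFlow.Scoring.GaussVandermondeFourthMoment
import HarnessLib

/-!
# Equipartition at weak coupling for the `U(N)` plaquette, every `N`: `β² · Var_β(Re tr U_p) → N²/2 = dim U(N)/2` as `β → ∞`

HONEST FRAMING: exact (Metropolis-corrected) sampling algorithms for lattice gauge theory;
figures of merit are autocorrelation/cost numbers at stated couplings and volumes; no
continuum-physics claim.

Venture `LatticeQCDFlow` (cell pub-lqcd), sub-topic `Scoring`; FANOUT row 5 (`s0-sun-a`), GEN-20.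
NEW WORK of the cell (placement rule).  GEN-20 `PlaquetteWeakCoupling` proved the one-loop law of the MEAN,
`β(1 − P_N(β)) → N/2`.  Here the one-loop law of the VARIANCE of the `U(N)` one-plaquette (= 2-d infinite-volume,
GEN-19 (24)) law — the "specific heat per plaquette" `β² (log det[I_{|i−j|}])″(β) = β² Var_β(Re tr U)` — by Laplace's
method with the SQUARED weight `(Σ_b x(1 − cos θ_b))² → (Σφ²/2)²` and the fourth moment
`∫ (Σφ²)² e^{−Σφ²/2}Δ² = N²(N²+2) M_N` (`GaussVandermondeFourthMoment`):

* §1 **`integral_haar_unitaryGroup_sub_trace_sq_mul_exp`** — Weyl's formula for the class function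
  `(N − Re tr U)² e^{x Re tr U}`;
* §2 `integral_sqWeightedScaledIntegrand_eq` (change of variables), **`tendsto_integral_sqWeightedScaledIntegrand`**
  (`→ (N²(N²+2)/4) M_N`);
* §3 **`tendsto_sq_mul_iteratedDeriv_two_log_det_besselI_toeplitz`** — `x² · (log det[I_{|i−j|}])″(x) → N²/2` as `x → ∞`
  (`x²⟨(N − Re tr)²⟩ → N²(N²+2)/4` minus the square of GEN-20's `x⟨N − Re tr⟩ → N²/2`), and
  **`tendsto_sq_mul_unitary_plaquette_variance`** — `β² · Var_β(N⁻¹ Re tr U) → 1/2` for every `N ≥ 1`: each of the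
  `N² = dim U(N)` quadratic modes of `N − Re tr U` carries variance `(1 + o(1))/(2β²)` (equipartition), exactly.

No `def`, nothing cited as a fact, 0 sorry.
-/

noncomputable section

open Real MeasureTheory Filter Topology Finset
open scoped ENNReal
open Complex (I)
open ProbabilityTheory
open Literature.MathematicalPhysics.QuantumFieldTheory (haarProbability)
open Literature.Analysis.FunctionSpaces (besselI)
open Literature.RepresentationTheory.CompactGroups
open Literature.RepresentationTheory.CompactGroups.WeylIntegration

namespace Summit.Ventures.LatticeQCDFlow.Scoring

/-! ### 1. Weyl's formula for `(N − Re tr U)² e^{x Re tr U}` -/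

/-- The torus integrand `(Σ_b (1 − cos θ_b))² e^{xΣcos θ} Π|e^{iθ_j} − e^{iθ_k}|²` is continuous. -/
theorem continuous_cube_weighted_sq (N : ℕ) (x : ℝ) :
    Continuous (fun θ : Fin N → ℝ => (∑ b, (1 - Real.cos (θ b))) ^ 2 * (Real.exp (x * ∑ b, Real.cos (θ b)) *
            ∏ p : OD (Fin N), ‖Complex.exp (θ p.1.1 * I) - Complex.exp (θ p.1.2 * I)‖ ^ 2)) := by
  refine ((continuous_finsetSum _ fun b _ => continuous_const.sub (Real.continuous_cos.comp
    (continuous_apply b))).pow 2).mul ((Real.continuous_exp.comp (continuous_const.mul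
      (continuous_finsetSum _ fun b _ => Real.continuous_cos.comp (continuous_apply b)))).mul
        (continuous_finsetProd _ fun p _ => ?_))
  exact ((Complex.continuous_exp.comp ((Complex.continuous_ofReal.comp (continuous_apply _)).mul
    continuous_const)).sub (Complex.continuous_exp.comp ((Complex.continuous_ofReal.comp
      (continuous_apply _)).mul continuous_const))).norm.pow 2

/-- The squared-weight torus integrand is integrable on the cube (it is at most `(2N)²` times the unweighted one). -/
theorem integrable_cube_weighted_sq (N : ℕ) (x : ℝ) :
    Integrable (fun θ : Fin N → ℝ => (∑ b, (1 - Real.cos (θ b))) ^ 2 * (Real.exp (x * ∑ b, Real.cos (θ b)) *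
            ∏ p : OD (Fin N), ‖Complex.exp (θ p.1.1 * I) - Complex.exp (θ p.1.2 * I)‖ ^ 2))
      (Measure.pi fun _ : Fin N => (volume : Measure ℝ).restrict (Set.Ioc (-π) π)) := by
  have h := integrable_cube_exp_mul_sum_cos_mul_prod_norm_sub_sq (n := Fin N) x
  refine (h.const_mul ((2 * N) ^ 2)).mono' (continuous_cube_weighted_sq N x).aestronglyMeasurable
    (Eventually.of_forall fun θ => ?_)
  have hF0 : 0 ≤ Real.exp (x * ∑ b, Real.cos (θ b)) *
      ∏ p : OD (Fin N), ‖Complex.exp (θ p.1.1 * I) - Complex.exp (θ p.1.2 * I)‖ ^ 2 :=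
    mul_nonneg (Real.exp_nonneg _) (Finset.prod_nonneg fun p _ => sq_nonneg _)
  have hS0 : 0 ≤ ∑ b : Fin N, (1 - Real.cos (θ b)) := Finset.sum_nonneg fun b _ => by linarith [Real.cos_le_one (θ b)]
  have hS : ∑ b : Fin N, (1 - Real.cos (θ b)) ≤ 2 * N := by
    calc ∑ b : Fin N, (1 - Real.cos (θ b)) ≤ ∑ _b : Fin N, (2 : ℝ) :=
          Finset.sum_le_sum fun b _ => by linarith [Real.neg_one_le_cos (θ b)]
      _ = 2 * N := by simp [mul_comm]
  rw [Real.norm_eq_abs, abs_of_nonneg (mul_nonneg (sq_nonneg _) hF0)]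
  exact mul_le_mul_of_nonneg_right (pow_le_pow_left₀ hS0 hS 2) hF0

/-- **Weyl's formula for the class function `(N − Re tr U)² e^{x Re tr U}`** on `U(N)`:
`∫_{U(N)} (N − Re tr U)² e^{x Re tr U} dU = ((2π)^N N!)⁻¹ ∫_{(−π,π]^N} (Σ_b (1 − cos θ_b))² e^{xΣ_b cos θ_b} Π_{j≺k}|e^{iθ_j} − e^{iθ_k}|² dθ`. -/
theorem integral_haar_unitaryGroup_sub_trace_sq_mul_exp (N : ℕ) (x : ℝ) :
    ∫ u, (((N : ℝ) - ((u : Matrix.unitaryGroup (Fin N) ℂ) : Matrix (Fin N) (Fin N) ℂ).trace.re) ^ 2 *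
        Real.exp (x * ((u : Matrix.unitaryGroup (Fin N) ℂ) : Matrix (Fin N) (Fin N) ℂ).trace.re))
        ∂(haarProbability (Matrix.unitaryGroup (Fin N) ℂ))
      = ((2 * π) ^ N * N.factorial)⁻¹ *
        ∫ θ, (∑ b, (1 - Real.cos (θ b))) ^ 2 * (Real.exp (x * ∑ b, Real.cos (θ b)) *
            ∏ p : OD (Fin N), ‖Complex.exp (θ p.1.1 * I) - Complex.exp (θ p.1.2 * I)‖ ^ 2)
          ∂(Measure.pi fun _ : Fin N => (volume : Measure ℝ).restrict (Set.Ioc (-π) π)) := by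
  have htr : Continuous fun u : Matrix.unitaryGroup (Fin N) ℂ =>
      ((u : Matrix.unitaryGroup (Fin N) ℂ) : Matrix (Fin N) (Fin N) ℂ).trace.re :=
    Complex.continuous_re.comp (continuous_id.matrix_trace.comp continuous_subtype_val)
  have hGc : Continuous fun u : Matrix.unitaryGroup (Fin N) ℂ =>
      (((N : ℝ) - ((u : Matrix.unitaryGroup (Fin N) ℂ) : Matrix (Fin N) (Fin N) ℂ).trace.re) ^ 2 *
        Real.exp (x * ((u : Matrix.unitaryGroup (Fin N) ℂ) : Matrix (Fin N) (Fin N) ℂ).trace.re)) :=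
    ((continuous_const.sub htr).pow 2).mul (Real.continuous_exp.comp (continuous_const.mul htr))
  have hG0 : ∀ u : Matrix.unitaryGroup (Fin N) ℂ, 0 ≤ (((N : ℝ) - ((u : Matrix.unitaryGroup (Fin N) ℂ) : Matrix (Fin N) (Fin N) ℂ).trace.re) ^ 2 * Real.exp (x * ((u : Matrix.unitaryGroup (Fin N) ℂ) : Matrix (Fin N) (Fin N) ℂ).trace.re)) := fun u =>
    mul_nonneg (sq_nonneg _) (Real.exp_nonneg _)
  have hF : Measurable fun u : Matrix.unitaryGroup (Fin N) ℂ => ENNReal.ofReal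
      ((((N : ℝ) - ((u : Matrix.unitaryGroup (Fin N) ℂ) : Matrix (Fin N) (Fin N) ℂ).trace.re) ^ 2 *
        Real.exp (x * ((u : Matrix.unitaryGroup (Fin N) ℂ) : Matrix (Fin N) (Fin N) ℂ).trace.re))) :=
    ENNReal.measurable_ofReal.comp hGc.measurable
  have hcl : ∀ g u : Matrix.unitaryGroup (Fin N) ℂ, ENNReal.ofReal
      ((((N : ℝ) - (((g * u * g⁻¹ : Matrix.unitaryGroup (Fin N) ℂ)) : Matrix (Fin N) (Fin N) ℂ).trace.re) ^ 2 *
        Real.exp (x * (((g * u * g⁻¹ : Matrix.unitaryGroup (Fin N) ℂ)) : Matrix (Fin N) (Fin N) ℂ).trace.re)))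
      = ENNReal.ofReal ((((N : ℝ) - ((u : Matrix.unitaryGroup (Fin N) ℂ) : Matrix (Fin N) (Fin N) ℂ).trace.re) ^ 2 *
        Real.exp (x * ((u : Matrix.unitaryGroup (Fin N) ℂ) : Matrix (Fin N) (Fin N) ℂ).trace.re))) := by
    intro g u; rw [trace_conj_unitaryGroup]
  have hW := lintegral_unitaryGroup_eq_angleIntegral hF hcl
  rw [angleIntegral] at hW
  simp_rw [trace_re_torusPt] at hW
  rw [show (volume : Measure (Fin N → ℝ)).restrict (Set.pi Set.univ fun _ => Set.Ioc (-π) π) =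
    Measure.pi fun _ : Fin N => (volume : Measure ℝ).restrict (Set.Ioc (-π) π) from Measure.restrict_pi_pi _ _] at hW
  have hsum : ∀ θ : Fin N → ℝ, ((N : ℝ) - ∑ b, Real.cos (θ b)) = ∑ b, (1 - Real.cos (θ b)) := by
    intro θ; rw [Finset.sum_sub_distrib, Finset.sum_const, Finset.card_univ, Fintype.card_fin, nsmul_eq_mul, mul_one]
  have hprod : ∀ θ : Fin N → ℝ,
      ENNReal.ofReal (((N : ℝ) - ∑ b, Real.cos (θ b)) ^ 2 * Real.exp (x * ∑ b, Real.cos (θ b))) *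
        ENNReal.ofReal (∏ p : OD (Fin N), ‖Complex.exp (θ p.1.1 * I) - Complex.exp (θ p.1.2 * I)‖ ^ 2)
      = ENNReal.ofReal ((∑ b, (1 - Real.cos (θ b))) ^ 2 * (Real.exp (x * ∑ b, Real.cos (θ b)) *
            ∏ p : OD (Fin N), ‖Complex.exp (θ p.1.1 * I) - Complex.exp (θ p.1.2 * I)‖ ^ 2)) := by
    intro θ
    rw [hsum, ← ENNReal.ofReal_mul (mul_nonneg (sq_nonneg _) (Real.exp_nonneg _)), mul_assoc]
  simp_rw [hprod] at hW
  have hnn : ∀ θ : Fin N → ℝ, 0 ≤ (∑ b, (1 - Real.cos (θ b))) ^ 2 * (Real.exp (x * ∑ b, Real.cos (θ b)) *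
            ∏ p : OD (Fin N), ‖Complex.exp (θ p.1.1 * I) - Complex.exp (θ p.1.2 * I)‖ ^ 2) := fun θ =>
    mul_nonneg (sq_nonneg _)
      (mul_nonneg (Real.exp_nonneg _) (Finset.prod_nonneg fun p _ => sq_nonneg _))
  rw [← ofReal_integral_eq_lintegral_ofReal (integrable_cube_weighted_sq N x) (Eventually.of_forall hnn)] at hW
  rw [integral_eq_lintegral_of_nonneg_ae (Eventually.of_forall hG0) hGc.aestronglyMeasurable, hW]
  simp only [Fintype.card_fin, ENNReal.toReal_mul, ENNReal.toReal_inv, ENNReal.toReal_pow,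
    ENNReal.toReal_ofReal Real.two_pi_pos.le, ENNReal.toReal_natCast, ENNReal.toReal_ofReal (integral_nonneg hnn)]

/-! ### 2. The weighted Laplace limit with the squared weight -/

/-- **Change of variables for the squared-weight integrand** (`x > 0`):
`∫_{ℝ^N} 1[φ/√x ∈ cube] (Σ_b x(1−cos(φ_b/√x)))² e^{Σ x(cos(φ_b/√x)−1)} Π 2x(1−cos((φ_j−φ_k)/√x)) dφ
 = e^{−Nx} x^{|OD|} √x^{N} · ∫_{cube} (Σ_b x(1 − cos θ_b))² e^{xΣcosθ} Π|e^{iθ_j}−e^{iθ_k}|² dθ`. -/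
theorem integral_sqWeightedScaledIntegrand_eq {N : ℕ} {x : ℝ} (hx : 0 < x) :
    ∫ φ : Fin N → ℝ, (∑ b, x * (1 - Real.cos (φ b / √x))) ^ 2 *
        ((fun φ : Fin N → ℝ => fun b => φ b / √x) ⁻¹' Set.univ.pi fun _ => Set.Ioc (-π) π).indicator
          (fun φ => Real.exp (∑ b, x * (Real.cos (φ b / √x) - 1)) *
            ∏ p : OD (Fin N), (2 * x * (1 - Real.cos ((φ p.1.1 - φ p.1.2) / √x)))) φ
      = Real.exp (-(N * x)) * x ^ Fintype.card (OD (Fin N)) * √x ^ N *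
        ∫ θ, (∑ b, x * (1 - Real.cos (θ b))) ^ 2 * (Real.exp (x * ∑ b, Real.cos (θ b)) *
            ∏ p : OD (Fin N), ‖Complex.exp (θ p.1.1 * I) - Complex.exp (θ p.1.2 * I)‖ ^ 2)
          ∂(Measure.pi fun _ : Fin N => (volume : Measure ℝ).restrict (Set.Ioc (-π) π)) := by
  have hsx : 0 < √x := Real.sqrt_pos.2 hx
  set c : ℝ := (√x)⁻¹ with hc
  set F : (Fin N → ℝ) → ℝ := fun θ => (∑ b, x * (1 - Real.cos (θ b))) ^ 2 * (Real.exp (x * ∑ b, Real.cos (θ b)) *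
    ∏ p : OD (Fin N), (2 - 2 * Real.cos (θ p.1.1 - θ p.1.2))) with hF
  set cube : Set (Fin N → ℝ) := Set.univ.pi fun _ => Set.Ioc (-π) π with hcube
  have hcube_meas : MeasurableSet cube := MeasurableSet.univ_pi fun _ => measurableSet_Ioc
  have htorus : ∫ θ, (∑ b, x * (1 - Real.cos (θ b))) ^ 2 * (Real.exp (x * ∑ b, Real.cos (θ b)) *
            ∏ p : OD (Fin N), ‖Complex.exp (θ p.1.1 * I) - Complex.exp (θ p.1.2 * I)‖ ^ 2)
        ∂(Measure.pi fun _ : Fin N => (volume : Measure ℝ).restrict (Set.Ioc (-π) π))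
      = ∫ θ : Fin N → ℝ, cube.indicator F θ := by
    simp_rw [norm_cexp_sub_cexp_sq]
    rw [← Measure.restrict_pi_pi, ← volume_pi, integral_indicator hcube_meas]
  have hscale : ∀ φ : Fin N → ℝ, (fun b => φ b / √x) = c • φ := by
    intro φ; funext b; simp [hc, div_eq_inv_mul]
  have hind : ∀ φ : Fin N → ℝ, (∑ b, x * (1 - Real.cos (φ b / √x))) ^ 2 *
      ((fun φ : Fin N → ℝ => fun b => φ b / √x) ⁻¹' cube).indicator
        (fun φ => Real.exp (∑ b, x * (Real.cos (φ b / √x) - 1)) *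
          ∏ p : OD (Fin N), (2 * x * (1 - Real.cos ((φ p.1.1 - φ p.1.2) / √x)))) φ
      = Real.exp (-(N * x)) * x ^ Fintype.card (OD (Fin N)) * (cube.indicator F) (c • φ) := by
    intro φ
    by_cases hφ : (fun b => φ b / √x) ∈ cube
    · rw [Set.indicator_of_mem (show φ ∈ (fun φ : Fin N → ℝ => fun b => φ b / √x) ⁻¹' cube from hφ),
        Set.indicator_of_mem (show c • φ ∈ cube by rwa [← hscale]), scaledIntegrand_eq_mul, hF, ← hscale]
      simp only [Fintype.card_fin]
      ring
    · rw [Set.indicator_of_notMem (show φ ∉ (fun φ : Fin N → ℝ => fun b => φ b / √x) ⁻¹' cube from hφ),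
        Set.indicator_of_notMem (show c • φ ∉ cube by rwa [← hscale]), mul_zero, mul_zero]
  simp_rw [hind]
  rw [integral_const_mul, Measure.integral_comp_smul volume (cube.indicator F) c, htorus,
    Module.finrank_fintype_fun_eq_card, smul_eq_mul]
  have hcN : |(c ^ Fintype.card (Fin N))⁻¹| = √x ^ N := by
    rw [Fintype.card_fin, hc, inv_pow, inv_inv, abs_of_pos (pow_pos hsx _)]
  rw [hcN]
  ring

/-- **The squared-weight Laplace limit**:
`∫ (weight)² × (scaled integrand) → ∫ (Σφ²/2)² e^{−Σφ²/2} Δ² = (N²(N²+2)/4) M_N`. -/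
theorem tendsto_integral_sqWeightedScaledIntegrand (N : ℕ) :
    Tendsto (fun x : ℝ => ∫ φ : Fin N → ℝ, (∑ b, x * (1 - Real.cos (φ b / √x))) ^ 2 *
        ((fun φ : Fin N → ℝ => fun b => φ b / √x) ⁻¹' Set.univ.pi fun _ => Set.Ioc (-π) π).indicator
          (fun φ => Real.exp (∑ b, x * (Real.cos (φ b / √x) - 1)) *
            ∏ p : OD (Fin N), (2 * x * (1 - Real.cos ((φ p.1.1 - φ p.1.2) / √x)))) φ)
      atTop (𝓝 ((N : ℝ) ^ 2 * ((N : ℝ) ^ 2 + 2) / 4 *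
        ∫ φ : Fin N → ℝ, Real.exp (∑ b, -(φ b ^ 2 / 2)) * ∏ p : OD (Fin N), (φ p.1.1 - φ p.1.2) ^ 2)) := by
  have hlim : (N : ℝ) ^ 2 * ((N : ℝ) ^ 2 + 2) / 4 *
      ∫ φ : Fin N → ℝ, Real.exp (∑ b, -(φ b ^ 2 / 2)) * ∏ p : OD (Fin N), (φ p.1.1 - φ p.1.2) ^ 2
      = ∫ φ : Fin N → ℝ, ((∑ b, φ b ^ 2) / 2) ^ 2 *
          (Real.exp (∑ b, -(φ b ^ 2 / 2)) * ∏ p : OD (Fin N), (φ p.1.1 - φ p.1.2) ^ 2) := by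
    have h := integral_normSq_sq_gaussVandermonde (n := Fin N)
    simp only [Fintype.card_fin] at h
    have e : (fun φ : Fin N → ℝ => ((∑ b, φ b ^ 2) / 2) ^ 2 *
        (Real.exp (∑ b, -(φ b ^ 2 / 2)) * ∏ p : OD (Fin N), (φ p.1.1 - φ p.1.2) ^ 2))
        = fun φ => (1 / 4) * ((∑ b, φ b ^ 2) ^ 2 *
          (Real.exp (∑ b, -(φ b ^ 2 / 2)) * ∏ p : OD (Fin N), (φ p.1.1 - φ p.1.2) ^ 2)) := by
      funext φ; ring
    rw [e, integral_const_mul, h]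
    ring
  rw [hlim]
  refine tendsto_integral_filter_of_dominated_convergence
    (fun φ => 2 ^ Fintype.card (OD (Fin N)) * ∏ b, (Real.exp (-(2 / π ^ 2 * φ b ^ 2)) *
      (1 + φ b ^ 2) ^ (Fintype.card (OD (Fin N)) + 2))) ?_ ?_ (integrable_gaussPolyBound _ _)
    (Eventually.of_forall fun φ => ((tendsto_laplaceWeight φ).pow 2).mul (tendsto_scaledIntegrand φ))
  · filter_upwards [eventually_gt_atTop (0 : ℝ)] with x hx
    refine (Continuous.aestronglyMeasurable (by fun_prop)).mul (AEStronglyMeasurable.indicator ?_ ?_)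
    · exact (by fun_prop : Continuous fun φ : Fin N → ℝ => Real.exp (∑ b, x * (Real.cos (φ b / √x) - 1)) *
        ∏ p : OD (Fin N), (2 * x * (1 - Real.cos ((φ p.1.1 - φ p.1.2) / √x)))).aestronglyMeasurable
    · exact (MeasurableSet.univ_pi fun _ => measurableSet_Ioc).preimage (by fun_prop)
  · filter_upwards [eventually_gt_atTop (0 : ℝ)] with x hx
    refine Eventually.of_forall fun φ => ?_
    have hw := laplaceWeight_mem_Icc hx φ
    have hw2 : (∑ b, x * (1 - Real.cos (φ b / √x))) ^ 2 ≤ ((∑ b, φ b ^ 2) / 2) ^ 2 := pow_le_pow_left₀ hw.1 hw.2 2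
    rw [norm_mul, Real.norm_eq_abs, abs_of_nonneg (sq_nonneg _), Real.norm_eq_abs]
    by_cases hφ : φ ∈ (fun φ : Fin N → ℝ => fun b => φ b / √x) ⁻¹' Set.univ.pi fun _ => Set.Ioc (-π) π
    · rw [Set.indicator_of_mem hφ, abs_of_nonneg (mul_nonneg (Real.exp_nonneg _)
        (Finset.prod_nonneg fun p _ => pairFactor_nonneg hx.le _))]
      have hb := scaledIntegrand_le_bound hx fun b => hφ b (Set.mem_univ _)
      have hsum : ((∑ b, φ b ^ 2) / 2) ^ 2 ≤ (∏ b, (1 + φ b ^ 2)) ^ 2 := by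
        have h1 := sq_sum_sq_le_prod_sq φ
        have h0 : 0 ≤ (∑ b, φ b ^ 2) ^ 2 := sq_nonneg _
        nlinarith
      calc (∑ b, x * (1 - Real.cos (φ b / √x))) ^ 2 * (Real.exp (∑ b, x * (Real.cos (φ b / √x) - 1)) *
            ∏ p : OD (Fin N), (2 * x * (1 - Real.cos ((φ p.1.1 - φ p.1.2) / √x))))
          ≤ (∏ b, (1 + φ b ^ 2)) ^ 2 * (2 ^ Fintype.card (OD (Fin N)) *
            ∏ b, (Real.exp (-(2 / π ^ 2 * φ b ^ 2)) * (1 + φ b ^ 2) ^ Fintype.card (OD (Fin N)))) :=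
            mul_le_mul (hw2.trans hsum) hb (mul_nonneg (Real.exp_nonneg _)
              (Finset.prod_nonneg fun p _ => pairFactor_nonneg hx.le _)) (by positivity)
        _ = 2 ^ Fintype.card (OD (Fin N)) * ∏ b, (Real.exp (-(2 / π ^ 2 * φ b ^ 2)) *
            (1 + φ b ^ 2) ^ (Fintype.card (OD (Fin N)) + 2)) := by
            rw [mul_left_comm, ← Finset.prod_pow, ← Finset.prod_mul_distrib]
            congr 1
            exact Finset.prod_congr rfl fun b _ => by ring
    · rw [Set.indicator_of_notMem hφ, abs_zero, mul_zero]
      exact mul_nonneg (by positivity) (Finset.prod_nonneg fun b _ => by positivity)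

/-! ### 3. Equipartition: the one-loop law of the plaquette variance -/

/-- **`x² · (log det[I_{|i−j|}])″(x) → N²/2`** as `x → ∞`, every `N`: the tilted variance of `Re tr U` under the
`U(N)` one-plaquette law at coupling `x` is `N²/(2x²)·(1 + o(1))`. -/
theorem tendsto_sq_mul_iteratedDeriv_two_log_det_besselI_toeplitz (N : ℕ) :
    Tendsto (fun x : ℝ => x ^ 2 * iteratedDeriv 2
        (fun y : ℝ => Real.log (Matrix.of fun i j : Fin N => besselI ((i : ℤ) - (j : ℤ)).natAbs y).det) x)
      atTop (𝓝 ((N : ℝ) ^ 2 / 2)) := by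
  set M : ℝ := ∫ φ : Fin N → ℝ, Real.exp (∑ b, -(φ b ^ 2 / 2)) * ∏ p : OD (Fin N), (φ p.1.1 - φ p.1.2) ^ 2 with hM
  have hMpos : 0 < M := gaussVandermonde_pos (n := Fin N)
  have hK : (0 : ℝ) < (2 * π) ^ N * N.factorial := by positivity
  have hden := tendsto_det_besselI_toeplitz_weakCoupling N
  -- the normalised second moment of `N − Re tr U`
  have hnum : Tendsto (fun x : ℝ => x ^ 2 * (∫ u, (((N : ℝ) - ((u : Matrix.unitaryGroup (Fin N) ℂ) : Matrix (Fin N) (Fin N) ℂ).trace.re) ^ 2 *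
        Real.exp (x * ((u : Matrix.unitaryGroup (Fin N) ℂ) : Matrix (Fin N) (Fin N) ℂ).trace.re)) ∂(haarProbability (Matrix.unitaryGroup (Fin N) ℂ))) *
      Real.exp (-(N * x)) * √x ^ (N ^ 2)) atTop
      (𝓝 ((N : ℝ) ^ 2 * ((N : ℝ) ^ 2 + 2) / 4 * M / ((2 * π) ^ N * N.factorial))) := by
    have h := (tendsto_integral_sqWeightedScaledIntegrand N).div_const ((2 * π) ^ N * N.factorial)
    refine h.congr' ?_
    filter_upwards [eventually_gt_atTop (0 : ℝ)] with x hx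
    have hpow : √x ^ (N ^ 2) = x ^ Fintype.card (OD (Fin N)) * √x ^ N := by
      have hc := card_add_two_mul_card_OD (n := Fin N)
      simp only [Fintype.card_fin] at hc
      rw [← hc, pow_add, pow_mul, Real.sq_sqrt hx.le, mul_comm]
    have hI : ∫ θ, (∑ b, x * (1 - Real.cos (θ b))) ^ 2 * (Real.exp (x * ∑ b, Real.cos (θ b)) *
            ∏ p : OD (Fin N), ‖Complex.exp (θ p.1.1 * I) - Complex.exp (θ p.1.2 * I)‖ ^ 2)
        ∂(Measure.pi fun _ : Fin N => (volume : Measure ℝ).restrict (Set.Ioc (-π) π))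
        = x ^ 2 * ∫ θ, (∑ b, (1 - Real.cos (θ b))) ^ 2 * (Real.exp (x * ∑ b, Real.cos (θ b)) *
            ∏ p : OD (Fin N), ‖Complex.exp (θ p.1.1 * I) - Complex.exp (θ p.1.2 * I)‖ ^ 2)
          ∂(Measure.pi fun _ : Fin N => (volume : Measure ℝ).restrict (Set.Ioc (-π) π)) := by
      rw [← integral_const_mul]
      refine integral_congr_ae (Eventually.of_forall fun θ => ?_)
      dsimp only
      generalize (Real.exp (x * ∑ b, Real.cos (θ b)) *
        ∏ p : OD (Fin N), ‖Complex.exp (θ p.1.1 * I) - Complex.exp (θ p.1.2 * I)‖ ^ 2) = R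
      rw [← Finset.mul_sum]
      ring
    rw [integral_sqWeightedScaledIntegrand_eq (N := N) hx, hI, integral_haar_unitaryGroup_sub_trace_sq_mul_exp, hpow]
    set J : ℝ := ∫ θ, (∑ b, (1 - Real.cos (θ b))) ^ 2 * (Real.exp (x * ∑ b, Real.cos (θ b)) *
            ∏ p : OD (Fin N), ‖Complex.exp (θ p.1.1 * I) - Complex.exp (θ p.1.2 * I)‖ ^ 2)
        ∂(Measure.pi fun _ : Fin N => (volume : Measure ℝ).restrict (Set.Ioc (-π) π)) with hJ
    field_simp
  have hne : M / ((2 * π) ^ N * N.factorial) ≠ 0 := (div_pos hMpos hK).ne'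
  have hq := hnum.div hden hne
  have hval : (N : ℝ) ^ 2 * ((N : ℝ) ^ 2 + 2) / 4 * M / ((2 * π) ^ N * N.factorial) /
      (M / ((2 * π) ^ N * N.factorial)) = (N : ℝ) ^ 2 * ((N : ℝ) ^ 2 + 2) / 4 := by
    field_simp
  rw [hval] at hq
  -- subtract the square of the normalised first moment (GEN-20 `PlaquetteWeakCoupling`)
  have hB := tendsto_mul_sub_deriv_log_det_besselI_toeplitz N
  have hlim := hq.sub (hB.mul hB)
  have hval2 : (N : ℝ) ^ 2 * ((N : ℝ) ^ 2 + 2) / 4 - (N : ℝ) ^ 2 / 2 * ((N : ℝ) ^ 2 / 2) = (N : ℝ) ^ 2 / 2 := by ring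
  rw [hval2] at hlim
  refine hlim.congr' ?_
  filter_upwards [eventually_gt_atTop (0 : ℝ)] with x hx
  simp only [Pi.div_apply]
  -- the dictionary `log det = cgf`, and the tilted variance
  have hint := mem_interior_integrableExpSet_of_abs_le_const
    (aestronglyMeasurable_trace_re_unitaryGroup N) (fun u => abs_trace_re_le_card u) x
  have hcgf : (fun y : ℝ => Real.log (Matrix.of fun i j : Fin N => besselI ((i : ℤ) - (j : ℤ)).natAbs y).det)
      = cgf (fun u : Matrix.unitaryGroup (Fin N) ℂ => ((u : Matrix.unitaryGroup (Fin N) ℂ) : Matrix (Fin N) (Fin N) ℂ).trace.re) (haarProbability (Matrix.unitaryGroup (Fin N) ℂ)) :=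
    funext fun y => by rw [cgf, mgf_trace_re_unitaryGroup]
  rw [hcgf, iteratedDeriv_two_cgf hint, deriv_cgf hint, mgf_trace_re_unitaryGroup]
  have hD := det_besselI_toeplitz_fin_pos N x
  -- integrability of the three pieces of `(N − Re tr)² e^{x Re tr}`
  have hbd : ∀ u : Matrix.unitaryGroup (Fin N) ℂ,
      |((u : Matrix.unitaryGroup (Fin N) ℂ) : Matrix (Fin N) (Fin N) ℂ).trace.re| ≤ N := fun u => by
    have h := abs_trace_re_le_card u
    rwa [Fintype.card_fin] at h
  have hexp_le : ∀ u : Matrix.unitaryGroup (Fin N) ℂ,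
      Real.exp (x * ((u : Matrix.unitaryGroup (Fin N) ℂ) : Matrix (Fin N) (Fin N) ℂ).trace.re) ≤ Real.exp (|x| * N) := by
    intro u
    refine Real.exp_le_exp.2 ?_
    calc x * ((u : Matrix.unitaryGroup (Fin N) ℂ) : Matrix (Fin N) (Fin N) ℂ).trace.re
        ≤ |x * ((u : Matrix.unitaryGroup (Fin N) ℂ) : Matrix (Fin N) (Fin N) ℂ).trace.re| := le_abs_self _
      _ = |x| * |((u : Matrix.unitaryGroup (Fin N) ℂ) : Matrix (Fin N) (Fin N) ℂ).trace.re| := abs_mul _ _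
      _ ≤ |x| * N := mul_le_mul_of_nonneg_left (hbd u) (abs_nonneg _)
  have hce : Continuous fun u : Matrix.unitaryGroup (Fin N) ℂ =>
      Real.exp (x * ((u : Matrix.unitaryGroup (Fin N) ℂ) : Matrix (Fin N) (Fin N) ℂ).trace.re) :=
    Real.continuous_exp.comp (continuous_const.mul (Complex.continuous_re.comp
      (continuous_id.matrix_trace.comp continuous_subtype_val)))
  have hctr : Continuous fun u : Matrix.unitaryGroup (Fin N) ℂ =>
      ((u : Matrix.unitaryGroup (Fin N) ℂ) : Matrix (Fin N) (Fin N) ℂ).trace.re :=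
    Complex.continuous_re.comp (continuous_id.matrix_trace.comp continuous_subtype_val)
  have hint0 : Integrable (fun u : Matrix.unitaryGroup (Fin N) ℂ => (N : ℝ) ^ 2 *
      Real.exp (x * ((u : Matrix.unitaryGroup (Fin N) ℂ) : Matrix (Fin N) (Fin N) ℂ).trace.re))
      (haarProbability (Matrix.unitaryGroup (Fin N) ℂ)) := by
    refine Integrable.mono' (integrable_const (((N : ℝ) ^ 2) * Real.exp (|x| * N))) (continuous_const.mul hce).aestronglyMeasurable
      (Eventually.of_forall fun u => ?_)
    rw [Real.norm_eq_abs, abs_of_nonneg (by positivity)]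
    exact mul_le_mul_of_nonneg_left (hexp_le u) (by positivity)
  have hint1 : Integrable (fun u : Matrix.unitaryGroup (Fin N) ℂ => 2 * (N : ℝ) *
      (((u : Matrix.unitaryGroup (Fin N) ℂ) : Matrix (Fin N) (Fin N) ℂ).trace.re *
        Real.exp (x * ((u : Matrix.unitaryGroup (Fin N) ℂ) : Matrix (Fin N) (Fin N) ℂ).trace.re)))
      (haarProbability (Matrix.unitaryGroup (Fin N) ℂ)) := by
    refine Integrable.mono' (integrable_const (2 * (N : ℝ) * ((N : ℝ) * Real.exp (|x| * N))))
      (continuous_const.mul (hctr.mul hce)).aestronglyMeasurable (Eventually.of_forall fun u => ?_)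
    rw [Real.norm_eq_abs, abs_mul, abs_of_nonneg (by positivity : (0 : ℝ) ≤ 2 * N), abs_mul, abs_of_nonneg (Real.exp_nonneg _)]
    exact mul_le_mul_of_nonneg_left (mul_le_mul (hbd u) (hexp_le u) (Real.exp_nonneg _) (Nat.cast_nonneg N))
      (by positivity)
  have hint2 : Integrable (fun u : Matrix.unitaryGroup (Fin N) ℂ =>
      ((u : Matrix.unitaryGroup (Fin N) ℂ) : Matrix (Fin N) (Fin N) ℂ).trace.re ^ 2 *
        Real.exp (x * ((u : Matrix.unitaryGroup (Fin N) ℂ) : Matrix (Fin N) (Fin N) ℂ).trace.re))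
      (haarProbability (Matrix.unitaryGroup (Fin N) ℂ)) := by
    refine Integrable.mono' (integrable_const (((N : ℝ) ^ 2) * Real.exp (|x| * N))) ((hctr.pow 2).mul hce).aestronglyMeasurable
      (Eventually.of_forall fun u => ?_)
    rw [Real.norm_eq_abs, abs_mul, abs_of_nonneg (sq_nonneg _), abs_of_nonneg (Real.exp_nonneg _)]
    refine mul_le_mul ?_ (hexp_le u) (Real.exp_nonneg _) (by positivity)
    rw [← sq_abs]
    exact pow_le_pow_left₀ (abs_nonneg _) (hbd u) 2
  have hint01 : Integrable (fun u : Matrix.unitaryGroup (Fin N) ℂ => (N : ℝ) ^ 2 *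
      Real.exp (x * ((u : Matrix.unitaryGroup (Fin N) ℂ) : Matrix (Fin N) (Fin N) ℂ).trace.re) - 2 * (N : ℝ) *
      (((u : Matrix.unitaryGroup (Fin N) ℂ) : Matrix (Fin N) (Fin N) ℂ).trace.re *
        Real.exp (x * ((u : Matrix.unitaryGroup (Fin N) ℂ) : Matrix (Fin N) (Fin N) ℂ).trace.re)))
      (haarProbability (Matrix.unitaryGroup (Fin N) ℂ)) := hint0.sub hint1
  have hsplit : ∫ u, (((N : ℝ) - ((u : Matrix.unitaryGroup (Fin N) ℂ) : Matrix (Fin N) (Fin N) ℂ).trace.re) ^ 2 *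
        Real.exp (x * ((u : Matrix.unitaryGroup (Fin N) ℂ) : Matrix (Fin N) (Fin N) ℂ).trace.re)) ∂(haarProbability (Matrix.unitaryGroup (Fin N) ℂ))
      = (N : ℝ) ^ 2 * (Matrix.of fun i j : Fin N => besselI ((i : ℤ) - (j : ℤ)).natAbs x).det
        - 2 * (N : ℝ) * ∫ u, (((u : Matrix.unitaryGroup (Fin N) ℂ) : Matrix (Fin N) (Fin N) ℂ).trace.re *
            Real.exp (x * ((u : Matrix.unitaryGroup (Fin N) ℂ) : Matrix (Fin N) (Fin N) ℂ).trace.re)) ∂(haarProbability (Matrix.unitaryGroup (Fin N) ℂ))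
        + ∫ u, (((u : Matrix.unitaryGroup (Fin N) ℂ) : Matrix (Fin N) (Fin N) ℂ).trace.re ^ 2 *
            Real.exp (x * ((u : Matrix.unitaryGroup (Fin N) ℂ) : Matrix (Fin N) (Fin N) ℂ).trace.re)) ∂(haarProbability (Matrix.unitaryGroup (Fin N) ℂ)) := by
    have h1 : ∫ u, (((N : ℝ) - ((u : Matrix.unitaryGroup (Fin N) ℂ) : Matrix (Fin N) (Fin N) ℂ).trace.re) ^ 2 *
        Real.exp (x * ((u : Matrix.unitaryGroup (Fin N) ℂ) : Matrix (Fin N) (Fin N) ℂ).trace.re)) ∂(haarProbability (Matrix.unitaryGroup (Fin N) ℂ))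
        = ∫ u, (((N : ℝ) ^ 2 * Real.exp (x * ((u : Matrix.unitaryGroup (Fin N) ℂ) : Matrix (Fin N) (Fin N) ℂ).trace.re) - 2 * (N : ℝ) *
            (((u : Matrix.unitaryGroup (Fin N) ℂ) : Matrix (Fin N) (Fin N) ℂ).trace.re *
              Real.exp (x * ((u : Matrix.unitaryGroup (Fin N) ℂ) : Matrix (Fin N) (Fin N) ℂ).trace.re))) +
            ((u : Matrix.unitaryGroup (Fin N) ℂ) : Matrix (Fin N) (Fin N) ℂ).trace.re ^ 2 *
              Real.exp (x * ((u : Matrix.unitaryGroup (Fin N) ℂ) : Matrix (Fin N) (Fin N) ℂ).trace.re)) ∂(haarProbability (Matrix.unitaryGroup (Fin N) ℂ)) :=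
      integral_congr_ae (Eventually.of_forall fun u => by ring)
    rw [h1, integral_add hint01 hint2, integral_sub hint0 hint1, integral_const_mul, integral_const_mul,
      integral_haar_unitaryGroup_fin_exp_mul_trace_re]
  rw [hsplit]
  have hE : Real.exp (-(N * x)) * √x ^ (N ^ 2) ≠ 0 := by positivity
  field_simp
  ring

/-- **EQUIPARTITION FOR THE `U(N)` PLAQUETTE, EVERY `N ≥ 1`**: with `P = N⁻¹ Re tr U` under the one-plaquette (and, in
two dimensions, infinite-volume) `U(N)` law `∝ e^{−β(N − Re tr U)} dU` at coupling `β`,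
`β² · Var_β(P) = β² (⟨P²⟩_β − ⟨P⟩_β²) → 1/2` as `β → ∞` (i.e. `β² Var_β(Re tr U_p) → N²/2 = dim U(N)/2`). -/
theorem tendsto_sq_mul_unitary_plaquette_variance (N : ℕ) [NeZero N] :
    Tendsto (fun β : ℝ => β ^ 2 * (
      (∫ u, (((u : Matrix.unitaryGroup (Fin N) ℂ) : Matrix (Fin N) (Fin N) ℂ).trace.re / N) ^ 2 *
          Real.exp (-(β * ((N : ℝ) - ((u : Matrix.unitaryGroup (Fin N) ℂ) : Matrix (Fin N) (Fin N) ℂ).trace.re)))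
        ∂(haarProbability (Matrix.unitaryGroup (Fin N) ℂ)))
      / (∫ u, Real.exp (-(β * ((N : ℝ) - ((u : Matrix.unitaryGroup (Fin N) ℂ) : Matrix (Fin N) (Fin N) ℂ).trace.re)))
        ∂(haarProbability (Matrix.unitaryGroup (Fin N) ℂ)))
      - ((∫ u, ((u : Matrix.unitaryGroup (Fin N) ℂ) : Matrix (Fin N) (Fin N) ℂ).trace.re / N *
          Real.exp (-(β * ((N : ℝ) - ((u : Matrix.unitaryGroup (Fin N) ℂ) : Matrix (Fin N) (Fin N) ℂ).trace.re)))
        ∂(haarProbability (Matrix.unitaryGroup (Fin N) ℂ)))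
      / (∫ u, Real.exp (-(β * ((N : ℝ) - ((u : Matrix.unitaryGroup (Fin N) ℂ) : Matrix (Fin N) (Fin N) ℂ).trace.re)))
        ∂(haarProbability (Matrix.unitaryGroup (Fin N) ℂ)))) ^ 2)) atTop (𝓝 (1 / 2)) := by
  simp_rw [unitary_plaquette_variance_eq]
  have hN : (N : ℝ) ≠ 0 := Nat.cast_ne_zero.2 (NeZero.ne N)
  have h := (tendsto_sq_mul_iteratedDeriv_two_log_det_besselI_toeplitz N).const_mul (1 / (N : ℝ) ^ 2)
  rw [show 1 / (N : ℝ) ^ 2 * ((N : ℝ) ^ 2 / 2) = 1 / 2 by field_simp] at h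
  refine h.congr fun β => ?_
  ring

end Summit.Ventures.LatticeQCDFlow.Scoring
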